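import Literature.NumberTheory.Sieve.SmoothRoughDecomposition
import Literature.NumberTheory.LFunctions.MertensFormula
import Mathlib.NumberTheory.ArithmeticFunction.Misc
import Mathlib.Analysis.SpecificLimits.Normed
import HarnessLib

/-!
# Divisor-power sums over rough numbers: `∑_{n ≤ x, (n, P(z)) = 1} τ(n)^k / n ≪_k (log x / log z)^{2^k}`

Topic `Literature/NumberTheory/Sieve`, sub-namespace `RoughSums`. Source-independent tools, all
PROVED, continuing `BombieriAsymptoticSieveMertens.lean` (`BombieriSieve.sum_le_prod_tsum_of_factored`,
`BombieriSieve.sum_inv_rough_le`: the case `k = 0`) and `SmoothRoughDecomposition.lean`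
(`prod_le_exp_sum`, `roughIcc`):

* `sum_primesGe_inv_le` — **Mertens' second theorem in a window, upper half**:
  `∑_{z ≤ p ≤ x} 1/p ≤ log(log x / log z) + 25` for all real `1 < z ≤ x` (from the tree's rate form
  `|∑_{p ≤ x} 1/p − log log x − B₁| ≤ 8/log x`, `Literature.NumberTheory.LFunctions.Mertens.abs_primeRecipSum_sub_le`,
  and the crude bound `B₁ ≤ 13` for the Meissel–Mertens constant, `meisselMertens_le`);
* `sum_primesGe_inv_sq_le` — `∑_{z ≤ p ≤ x} 1/p² ≤ 2/z`;
* `exists_tsum_succ_pow_mul_pow_le` — the Euler factor of `∑ τ(n)^k/n^s`-type series: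
  `∑_{a ≥ 0} (a+1)^k x^a ≤ 1 + 2^k x + D_k x²` for `0 ≤ x ≤ 1/2`;
* `exists_sum_rough_sigma_zero_pow_div_le` — **the standard estimate** ("when `f` is a
  divisor-bounded multiplicative function, `∑_{n ≤ X} |f(n)|/n ≪ ∏_{p ≤ X}(1 + |f(p)|/p)`" combined
  with Mertens, e.g. Matomäki–Merikoski, arXiv:2112.11412, §3.1 (eq:f(n)/n_average), (eq:Mertens)):
  for every `k` there is `C_k` with
  `∑_{d ≤ x, (d, P(z)) = 1} τ(d)^k / d ≤ C_k (log x / log z)^{2^k}` for all real `1 < z ≤ x`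
  (`P(z) = ∏_{p < z} p` is the tree's `primesProdBelow z`; `τ = σ₀`), and the same sum written
  with the filter "all prime factors `≥ z`" (`exists_sum_rough_sigma_zero_pow_div_le'`,
  `filter_primeFactors_ge_eq`).

## References

* K. Matomäki, J. Merikoski, *Siegel zeros, twin primes, Goldbach's conjecture, and primes in
  short intervals*, IMRN 2023 (arXiv:2112.11412), §3.1, (eq:f(n)/n_average) and (eq:Mertens).
  [cite: MatomakiMerikoski2023, §3.1]
* G. H. Hardy, E. M. Wright, *An Introduction to the Theory of Numbers*, 6th ed., Thm 427
  (Mertens' second theorem). [cite: HardyWright2008, Thm 427 (§22.7)]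
-/

noncomputable section

open Finset Real ArithmeticFunction
open scoped ArithmeticFunction.sigma

namespace Literature.NumberTheory.Sieve

namespace RoughSums

open Literature.NumberTheory.LFunctions

/-! ### Mertens' second theorem in a window -/

/-- A crude bound for the Meissel–Mertens constant: `B₁ ≤ 13` (from the rate form of Mertens'
second theorem at `x = 2`, where `∑_{p ≤ 2} 1/p = 1/2`). [folklore] -/
theorem meisselMertens_le : Mertens.meisselMertens ≤ 13 := by
  have h := (abs_le.mp (Mertens.abs_primeRecipSum_sub_le (le_refl (2 : ℝ)))).1
  have hsum : Mertens.primeRecipSum 2 = 1 / 2 := by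
    rw [Mertens.primeRecipSum, show ⌊(2 : ℝ)⌋₊ = 2 by norm_num, Mertens.primesLE_two,
      sum_singleton]
    norm_num
  rw [hsum] at h
  have hlog2 : 0.6931471803 < Real.log 2 := Real.log_two_gt_d9
  have hlog2' : Real.log 2 < 1 := by linarith [Real.log_two_lt_d9]
  have hlog20 : 0 < Real.log 2 := by linarith
  -- `−log log 2 ≤ 1/log 2 − 1` and `8/log 2 ≤ 12`
  have h1 : -Real.log (Real.log 2) ≤ (Real.log 2)⁻¹ - 1 := by
    rw [← Real.log_inv]
    exact Real.log_le_sub_one_of_pos (inv_pos.mpr hlog20)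
  have h2 : (Real.log 2)⁻¹ ≤ 3 / 2 := by
    rw [inv_le_comm₀ hlog20 (by norm_num)]
    linarith
  have h3 : 8 / Real.log 2 ≤ 12 := by
    rw [div_le_iff₀ hlog20]
    linarith
  linarith

/-- **Mertens' second theorem in a window (upper half).** For real `1 < z ≤ x`,
`∑_{z ≤ p ≤ x} 1/p ≤ log(log x / log z) + 25`. [cite: HardyWright2008, Thm 427 (§22.7)] -/
theorem sum_primesGe_inv_le {z x : ℝ} (hz : 1 < z) (hzx : z ≤ x) :
    ∑ p ∈ (Nat.primesLE ⌊x⌋₊).filter (fun p : ℕ => z ≤ (p : ℝ)), (p : ℝ)⁻¹ ≤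
      Real.log (Real.log x / Real.log z) + 25 := by
  have hlog2 : 0.6931471803 < Real.log 2 := Real.log_two_gt_d9
  have hlog2' : Real.log 2 < 1 := by linarith [Real.log_two_lt_d9]
  have hlog20 : 0 < Real.log 2 := by linarith
  have hz0 : 0 < z := by linarith
  have hx1 : 1 < x := by linarith
  have hlogz : 0 < Real.log z := Real.log_pos hz
  have hlogx : 0 < Real.log x := Real.log_pos hx1
  have hlogzx : Real.log z ≤ Real.log x := Real.log_le_log hz0 hzx
  have ht : Real.log (Real.log x / Real.log z) = Real.log (Real.log x) - Real.log (Real.log z) :=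
    Real.log_div hlogx.ne' hlogz.ne'
  have ht0 : 0 ≤ Real.log (Real.log x / Real.log z) :=
    Real.log_nonneg ((one_le_div hlogz).mpr hlogzx)
  have hB := meisselMertens_le
  have h8 : ∀ y : ℝ, 2 ≤ y → 8 / Real.log y ≤ 12 := fun y hy => by
    have : 8 / Real.log y ≤ 8 / Real.log 2 :=
      div_le_div_of_nonneg_left (by norm_num) hlog20 (Real.log_le_log two_pos hy)
    refine this.trans ?_
    rw [div_le_iff₀ hlog20]
    linarith
  rcases le_or_gt z 2 with hz2 | hz2
  · -- `z ≤ 2`: all primes `≤ x`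
    have hfilter : (Nat.primesLE ⌊x⌋₊).filter (fun p : ℕ => z ≤ (p : ℝ)) = Nat.primesLE ⌊x⌋₊ := by
      refine filter_true_of_mem fun p hp => ?_
      have h2p : (2 : ℝ) ≤ p := by exact_mod_cast (Nat.mem_primesLE.mp hp).2.two_le
      linarith
    rw [hfilter]
    rcases lt_or_ge x 2 with hx2 | hx2
    · have hfl : ⌊x⌋₊ = 1 := by
        rw [Nat.floor_eq_iff (by linarith)]
        constructor <;> norm_num <;> linarith
      rw [hfl, Nat.primesLE_one, sum_empty]
      linarith
    · have hM := (abs_le.mp (Mertens.abs_primeRecipSum_sub_le hx2)).2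
      have hsum : ∑ p ∈ Nat.primesLE ⌊x⌋₊, (p : ℝ)⁻¹ = Mertens.primeRecipSum x := rfl
      rw [hsum]
      -- `log log z ≤ log log 2 < 0`
      have hllz : Real.log (Real.log z) ≤ 0 :=
        Real.log_nonpos hlogz.le ((Real.log_le_log hz0 hz2).trans hlog2'.le)
      linarith [h8 x hx2]
  · -- `z > 2`: the window is `primesLE ⌊x⌋ \ primesLE n₀`, `n₀ = ⌈z⌉ − 1 ≥ 2`
    set n₀ : ℕ := ⌈z⌉₊ - 1 with hn₀
    have hceil3 : 3 ≤ ⌈z⌉₊ := Nat.lt_ceil.mpr (by exact_mod_cast hz2)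
    have hn₀2 : 2 ≤ n₀ := by omega
    have hn₀R : (n₀ : ℝ) = ⌈z⌉₊ - 1 := by rw [hn₀, Nat.cast_sub (by omega), Nat.cast_one]
    have hn₀z : (n₀ : ℝ) < z := by rw [hn₀R]; linarith [Nat.ceil_lt_add_one hz0.le]
    have hn₀z' : z ≤ (n₀ : ℝ) + 1 := by rw [hn₀R]; linarith [Nat.le_ceil z]
    have hn₀x : n₀ ≤ ⌊x⌋₊ := Nat.le_floor (by linarith)
    have hsub : Nat.primesLE n₀ ⊆ Nat.primesLE ⌊x⌋₊ := fun p hp => by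
      rw [Nat.mem_primesLE] at hp ⊢
      exact ⟨hp.1.trans hn₀x, hp.2⟩
    have hfilter : (Nat.primesLE ⌊x⌋₊).filter (fun p : ℕ => z ≤ (p : ℝ)) =
        Nat.primesLE ⌊x⌋₊ \ Nat.primesLE n₀ := by
      ext p
      simp only [mem_filter, mem_sdiff, Nat.mem_primesLE]
      constructor
      · rintro ⟨⟨hpx, hpp⟩, hzp⟩
        refine ⟨⟨hpx, hpp⟩, fun ⟨hpn, _⟩ => ?_⟩
        have : (p : ℝ) ≤ n₀ := by exact_mod_cast hpn
        linarith
      · rintro ⟨⟨hpx, hpp⟩, hnot⟩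
        refine ⟨⟨hpx, hpp⟩, ?_⟩
        have hpn : ¬ p ≤ n₀ := fun h => hnot ⟨h, hpp⟩
        have : (n₀ : ℝ) + 1 ≤ p := by exact_mod_cast Nat.lt_of_not_le hpn
        linarith
    have hwindow : ∑ p ∈ (Nat.primesLE ⌊x⌋₊).filter (fun p : ℕ => z ≤ (p : ℝ)), (p : ℝ)⁻¹ =
        Mertens.primeRecipSum x - Mertens.primeRecipSum n₀ := by
      rw [hfilter, Finset.sum_sdiff_eq_sub hsub, Mertens.primeRecipSum, Mertens.primeRecipSum,
        Nat.floor_natCast]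
    rw [hwindow]
    have hx2 : (2 : ℝ) ≤ x := by linarith
    have hn₀2R : (2 : ℝ) ≤ n₀ := by exact_mod_cast hn₀2
    have hMx := (abs_le.mp (Mertens.abs_primeRecipSum_sub_le hx2)).2
    have hMn := (abs_le.mp (Mertens.abs_primeRecipSum_sub_le hn₀2R)).1
    have hlogn : 0 < Real.log n₀ := Real.log_pos (by linarith)
    -- `log n₀ ≥ (log z)/2`, hence `log log n₀ ≥ log log z − log 2`
    have hlognz : Real.log z ≤ 2 * Real.log n₀ := by
      rcases le_or_gt z 4 with hz4 | hz4
      · calc Real.log z ≤ Real.log 4 := Real.log_le_log hz0 hz4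
          _ = 2 * Real.log 2 := by
              rw [show (4 : ℝ) = 2 ^ 2 by norm_num, Real.log_pow]; norm_num
          _ ≤ 2 * Real.log n₀ := by linarith [Real.log_le_log two_pos hn₀2R]
      · have h5 : (z - 1) ^ 2 ≤ (n₀ : ℝ) ^ 2 := pow_le_pow_left₀ (by linarith) (by linarith) 2
        have h6 : z ≤ (z - 1) ^ 2 := by nlinarith
        calc Real.log z ≤ Real.log ((n₀ : ℝ) ^ 2) := Real.log_le_log hz0 (h6.trans h5)
          _ = 2 * Real.log n₀ := by rw [Real.log_pow]; norm_num
    have hll : Real.log (Real.log z) ≤ Real.log (Real.log n₀) + Real.log 2 := by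
      rw [← Real.log_mul hlogn.ne' two_ne_zero, mul_comm]
      exact Real.log_le_log hlogz hlognz
    linarith [h8 x hx2, h8 (n₀ : ℝ) hn₀2R]

/-- `∑_{z ≤ p ≤ x} 1/p² ≤ 2/z` for `z > 1`. [folklore] -/
theorem sum_primesGe_inv_sq_le {z : ℝ} (hz : 1 < z) (x : ℝ) :
    ∑ p ∈ (Nat.primesLE ⌊x⌋₊).filter (fun p : ℕ => z ≤ (p : ℝ)), (p : ℝ)⁻¹ ^ 2 ≤ 2 / z := by
  have hz0 : 0 < z := by linarith
  set k : ℕ := ⌈z⌉₊ - 1 with hk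
  have hceil : 2 ≤ ⌈z⌉₊ := Nat.lt_ceil.mpr (by exact_mod_cast hz)
  have hk1 : ((k : ℝ) + 1) = ⌈z⌉₊ := by
    rw [hk, Nat.cast_sub (by omega), Nat.cast_one]
    ring
  have hsub : (Nat.primesLE ⌊x⌋₊).filter (fun p : ℕ => z ≤ (p : ℝ)) ⊆ Ioo k (⌊x⌋₊ + 1) := by
    intro p hp
    rw [mem_filter, Nat.mem_primesLE] at hp
    rw [mem_Ioo]
    have : ⌈z⌉₊ ≤ p := Nat.ceil_le.mpr hp.2
    omega
  calc ∑ p ∈ (Nat.primesLE ⌊x⌋₊).filter (fun p : ℕ => z ≤ (p : ℝ)), (p : ℝ)⁻¹ ^ 2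
      ≤ ∑ p ∈ Ioo k (⌊x⌋₊ + 1), (p : ℝ)⁻¹ ^ 2 :=
        sum_le_sum_of_subset_of_nonneg hsub fun p _ _ => by positivity
    _ = ∑ p ∈ Ioo k (⌊x⌋₊ + 1), ((p : ℝ) ^ 2)⁻¹ := by simp_rw [inv_pow]
    _ ≤ 2 / ((k : ℝ) + 1) := sum_Ioo_inv_sq_le k (⌊x⌋₊ + 1)
    _ = 2 / (⌈z⌉₊ : ℝ) := by rw [hk1]
    _ ≤ 2 / z := div_le_div_of_nonneg_left (by norm_num) hz0 (Nat.le_ceil z)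

/-! ### The Euler factor `∑_a (a+1)^k x^a` -/

/-- `(i + 1)^k ≤ 2^k (i^k + 1)` for `i : ℕ`. [folklore] -/
theorem succ_pow_le_two_pow_mul (k i : ℕ) : ((i : ℝ) + 1) ^ k ≤ 2 ^ k * ((i : ℝ) ^ k + 1) := by
  rcases Nat.eq_zero_or_pos i with rfl | hi
  · rw [Nat.cast_zero, zero_add, one_pow]
    have h1 : (1 : ℝ) ≤ 2 ^ k := one_le_pow₀ (by norm_num)
    have h2 : (1 : ℝ) ≤ (0 : ℝ) ^ k + 1 := by
      have : (0 : ℝ) ≤ (0 : ℝ) ^ k := pow_nonneg le_rfl k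
      linarith
    nlinarith
  · have hi1 : (1 : ℝ) ≤ i := by exact_mod_cast hi
    calc ((i : ℝ) + 1) ^ k ≤ (2 * (i : ℝ)) ^ k := pow_le_pow_left₀ (by positivity) (by linarith) k
      _ = 2 ^ k * (i : ℝ) ^ k := mul_pow _ _ _
      _ ≤ 2 ^ k * ((i : ℝ) ^ k + 1) := by
          refine mul_le_mul_of_nonneg_left (by linarith) (by positivity)

/-- Summability of `(i + c)^k r^i` for `0 ≤ r < 1`, `c ≥ 0`. [folklore] -/
theorem summable_add_pow_mul_geometric (k : ℕ) {c r : ℝ} (hc : 0 ≤ c) (hr0 : 0 ≤ r) (hr1 : r < 1) :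
    Summable (fun i : ℕ => ((i : ℝ) + c) ^ k * r ^ i) := by
  have hr : ‖r‖ < 1 := by rw [Real.norm_eq_abs, abs_of_nonneg hr0]; exact hr1
  have h1 : Summable (fun i : ℕ => (i : ℝ) ^ k * r ^ i) :=
    summable_pow_mul_geometric_of_norm_lt_one k hr
  have h2 : Summable (fun i : ℕ => r ^ i) := summable_geometric_of_lt_one hr0 hr1
  have h3 : Summable (fun i : ℕ => (c + 1) ^ k * 2 ^ k * ((i : ℝ) ^ k * r ^ i + r ^ i)) :=
    (h1.add h2).mul_left _
  refine Summable.of_nonneg_of_le (fun i => by positivity) (fun i => ?_) h3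
  have hic : (i : ℝ) + c ≤ (c + 1) * ((i : ℝ) + 1) := by nlinarith [Nat.cast_nonneg (α := ℝ) i]
  calc ((i : ℝ) + c) ^ k * r ^ i ≤ ((c + 1) * ((i : ℝ) + 1)) ^ k * r ^ i :=
        mul_le_mul_of_nonneg_right (pow_le_pow_left₀ (by positivity) hic k) (by positivity)
    _ = (c + 1) ^ k * ((i : ℝ) + 1) ^ k * r ^ i := by rw [mul_pow]
    _ ≤ (c + 1) ^ k * (2 ^ k * ((i : ℝ) ^ k + 1)) * r ^ i :=
        mul_le_mul_of_nonneg_right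
          (mul_le_mul_of_nonneg_left (succ_pow_le_two_pow_mul k i) (by positivity)) (by positivity)
    _ = (c + 1) ^ k * 2 ^ k * ((i : ℝ) ^ k * r ^ i + r ^ i) := by ring

/-- **The Euler factor of a `τ^k`-series.** For every `k` there is `D ≥ 0` such that for all
`0 ≤ x ≤ 1/2` the series `∑_{a ≥ 0} (a+1)^k x^a` converges and is `≤ 1 + 2^k x + D x²`
(`D = ∑_a (a+3)^k 2^{-a}`). [folklore] -/
theorem exists_tsum_succ_pow_mul_pow_le (k : ℕ) :
    ∃ D : ℝ, 0 ≤ D ∧ ∀ x : ℝ, 0 ≤ x → x ≤ 1 / 2 →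
      Summable (fun a : ℕ => ((a : ℝ) + 1) ^ k * x ^ a) ∧
        ∑' a : ℕ, ((a : ℝ) + 1) ^ k * x ^ a ≤ 1 + 2 ^ k * x + D * x ^ 2 := by
  have hD := summable_add_pow_mul_geometric k (by norm_num : (0 : ℝ) ≤ 3)
    (by norm_num : (0 : ℝ) ≤ 1 / 2) (by norm_num)
  refine ⟨∑' a : ℕ, ((a : ℝ) + 3) ^ k * (1 / 2) ^ a, tsum_nonneg fun a => by positivity, ?_⟩
  intro x hx0 hx1
  have hx1' : x < 1 := by linarith
  have hf : Summable (fun a : ℕ => ((a : ℝ) + 1) ^ k * x ^ a) :=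
    summable_add_pow_mul_geometric k zero_le_one hx0 hx1'
  refine ⟨hf, ?_⟩
  have hf1 : Summable (fun a : ℕ => (((a + 1 : ℕ) : ℝ) + 1) ^ k * x ^ (a + 1)) :=
    (summable_nat_add_iff 1).mpr hf
  have hf2 : Summable (fun a : ℕ => (((a + 1 + 1 : ℕ) : ℝ) + 1) ^ k * x ^ (a + 1 + 1)) :=
    (summable_nat_add_iff 1).mpr hf1
  rw [hf.tsum_eq_zero_add, hf1.tsum_eq_zero_add]
  simp only [Nat.cast_zero, zero_add, one_pow, pow_zero, mul_one, Nat.cast_one, pow_one]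
  -- the tail
  have htail : ∑' a : ℕ, (((a + 1 + 1 : ℕ) : ℝ) + 1) ^ k * x ^ (a + 1 + 1) ≤
      ∑' a : ℕ, ((a : ℝ) + 3) ^ k * (1 / 2) ^ a * x ^ 2 := by
    refine hf2.tsum_le_tsum (fun a => ?_) (hD.mul_right _)
    have hcast : (((a + 1 + 1 : ℕ) : ℝ) + 1) = (a : ℝ) + 3 := by push_cast; ring
    have hxpow : x ^ (a + 1 + 1) = x ^ a * x ^ 2 := by ring
    rw [hcast, hxpow, ← mul_assoc]
    refine mul_le_mul_of_nonneg_right ?_ (by positivity)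
    exact mul_le_mul_of_nonneg_left (pow_le_pow_left₀ hx0 hx1 a) (by positivity)
  rw [tsum_mul_right] at htail
  have h2k : (1 + 1 : ℝ) ^ k * x = 2 ^ k * x := by norm_num
  linarith

/-! ### `∑_{d ≤ x, (d, P(z)) = 1} τ(d)^k / d` -/

/-- **Divisor powers over rough numbers.** For every `k` there is `C > 0` such that for all real
`1 < z ≤ x`: `∑_{d ≤ x, (d, P(z)) = 1} τ(d)^k / d ≤ C (log x / log z)^{2^k}`
(`τ = σ₀`; the Euler product over the primes of `[z, x]`, whose factor at `p` is
`≤ 1 + 2^k/p + D/p² ≤ exp(2^k/p + D/p²)`, and Mertens' theorem in the window).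
[cite: MatomakiMerikoski2023, §3.1 (eq:f(n)/n_average), (eq:Mertens)] -/
theorem exists_sum_rough_sigma_zero_pow_div_le (k : ℕ) :
    ∃ C : ℝ, 0 < C ∧ ∀ z x : ℝ, 1 < z → z ≤ x →
      ∑ d ∈ (Ioc 0 ⌊x⌋₊).filter (fun d : ℕ => d.Coprime (primesProdBelow z)),
          ((σ 0 d : ℕ) : ℝ) ^ k / d ≤ C * (Real.log x / Real.log z) ^ 2 ^ k := by
  obtain ⟨D, hD0, hD⟩ := exists_tsum_succ_pow_mul_pow_le k
  refine ⟨Real.exp (2 ^ k * 25 + 2 * D), Real.exp_pos _, ?_⟩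
  intro z x hz hzx
  have hz0 : 0 < z := by linarith
  have hx1 : 1 < x := by linarith
  have hlogz : 0 < Real.log z := Real.log_pos hz
  have hlogx : 0 < Real.log x := Real.log_pos hx1
  set t : ℝ := Real.log x / Real.log z with ht
  have ht1 : 1 ≤ t := by
    rw [ht, le_div_iff₀ hlogz, one_mul]
    exact Real.log_le_log hz0 hzx
  have ht0 : 0 < t := by linarith
  -- the weight `h(n) = τ(n)^k / n`
  set h : ℕ → ℝ := fun n => ((σ 0 n : ℕ) : ℝ) ^ k / n with hh
  have h0 : ∀ n, 0 ≤ h n := fun n => by positivity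
  have h1 : h 1 = 1 := by
    simp only [hh, (isMultiplicative_sigma (k := 0)).map_one, Nat.cast_one, one_pow, div_one]
  have hmul : ∀ {m n : ℕ}, Nat.Coprime m n → h (m * n) = h m * h n := by
    intro m n hmn
    simp only [hh]
    rw [(isMultiplicative_sigma (k := 0)).map_mul_of_coprime hmn, Nat.cast_mul, mul_pow, Nat.cast_mul,
      div_mul_div_comm]
  have hpow : ∀ {p : ℕ}, p.Prime → ∀ e : ℕ, h (p ^ e) = ((e : ℝ) + 1) ^ k * ((p : ℝ)⁻¹) ^ e := by
    intro p hp e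
    simp only [hh]
    rw [sigma_zero_apply_prime_pow hp, Nat.cast_pow, div_eq_mul_inv, ← inv_pow]
    push_cast
    ring
  have hpinv : ∀ {p : ℕ}, p.Prime → 0 ≤ (p : ℝ)⁻¹ ∧ (p : ℝ)⁻¹ ≤ 1 / 2 := fun {p} hp => by
    have h2p : (2 : ℝ) ≤ p := by exact_mod_cast hp.two_le
    refine ⟨inv_nonneg.mpr (by linarith), ?_⟩
    rw [inv_eq_one_div]
    exact one_div_le_one_div_of_le two_pos h2p
  have hsum : ∀ {p : ℕ}, p.Prime → Summable (fun e : ℕ => h (p ^ e)) := by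
    intro p hp
    rw [show (fun e : ℕ => h (p ^ e)) = fun e : ℕ => ((e : ℝ) + 1) ^ k * ((p : ℝ)⁻¹) ^ e from
      funext (hpow hp)]
    exact (hD _ (hpinv hp).1 (hpinv hp).2).1
  -- the window of primes
  set W : Finset ℕ := (Nat.primesLE ⌊x⌋₊).filter (fun p : ℕ => z ≤ (p : ℝ)) with hW
  have hWp : ∀ p ∈ W, p.Prime := fun p hp => (BombieriSieve.mem_primesGe.mp hp).1
  -- Step 1: Euler product majorant
  have hstep1 : ∑ d ∈ (Ioc 0 ⌊x⌋₊).filter (fun d : ℕ => d.Coprime (primesProdBelow z)), h d ≤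
      ∏ p ∈ W, ∑' e : ℕ, h (p ^ e) :=
    BombieriSieve.sum_le_prod_tsum_of_factored h1 hmul h0 hsum hWp
      fun d hd => BombieriSieve.mem_factoredNumbers_of_rough hd
  -- Step 2: the factors
  have hfac : ∀ p ∈ W, ∑' e : ℕ, h (p ^ e) ≤
      1 + (2 ^ k * (p : ℝ)⁻¹ + D * ((p : ℝ)⁻¹) ^ 2) := by
    intro p hp
    have hp' := hWp p hp
    rw [show (fun e : ℕ => h (p ^ e)) = fun e : ℕ => ((e : ℝ) + 1) ^ k * ((p : ℝ)⁻¹) ^ e from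
      funext (hpow hp')]
    have := (hD _ (hpinv hp').1 (hpinv hp').2).2
    linarith
  have hstep2 : ∏ p ∈ W, ∑' e : ℕ, h (p ^ e) ≤
      Real.exp (∑ p ∈ W, (2 ^ k * (p : ℝ)⁻¹ + D * ((p : ℝ)⁻¹) ^ 2)) :=
    prod_le_exp_sum W (fun p _ => tsum_nonneg fun e => h0 _) hfac
  -- Step 3: Mertens in the window
  have hstep3 : ∑ p ∈ W, (2 ^ k * (p : ℝ)⁻¹ + D * ((p : ℝ)⁻¹) ^ 2) ≤
      2 ^ k * Real.log t + (2 ^ k * 25 + 2 * D) := by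
    rw [sum_add_distrib, ← mul_sum, ← mul_sum]
    have hA := sum_primesGe_inv_le hz hzx
    have hB := sum_primesGe_inv_sq_le hz x
    have hB' : 2 / z ≤ 2 := by
      rw [div_le_iff₀ hz0]
      linarith
    have h2k : (0 : ℝ) ≤ 2 ^ k := by positivity
    have := mul_le_mul_of_nonneg_left hA h2k
    have := mul_le_mul_of_nonneg_left (hB.trans hB') hD0
    linarith
  -- assemble
  calc ∑ d ∈ (Ioc 0 ⌊x⌋₊).filter (fun d : ℕ => d.Coprime (primesProdBelow z)), h d
      ≤ Real.exp (2 ^ k * Real.log t + (2 ^ k * 25 + 2 * D)) :=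
        hstep1.trans (hstep2.trans (Real.exp_le_exp.mpr hstep3))
    _ = Real.exp (2 ^ k * 25 + 2 * D) * t ^ 2 ^ k := by
        rw [Real.exp_add, mul_comm, show (2 : ℝ) ^ k = ((2 ^ k : ℕ) : ℝ) by push_cast; ring,
          Real.exp_nat_mul, Real.exp_log ht0]

/-- The two spellings of "`z`-rough": for real `z` and `t : ℕ`, the `1 ≤ n ≤ t` all of whose prime
factors are `≥ z` are the `0 < n ≤ t` with `(n, P(z)) = 1`. [folklore] -/
theorem filter_primeFactors_ge_eq (z : ℝ) (t : ℕ) :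
    (Icc 1 t).filter (fun n => ∀ p ∈ n.primeFactors, z ≤ ((p : ℕ) : ℝ)) =
      (Ioc 0 t).filter (fun d : ℕ => d.Coprime (primesProdBelow z)) := by
  rw [← roughIcc_ceil_eq, roughIcc]
  refine filter_congr fun n _ => ?_
  exact forall₂_congr fun p _ => Nat.ceil_le.symm

/-- `exists_sum_rough_sigma_zero_pow_div_le` with the rough numbers written as
`{1 ≤ n ≤ ⌊x⌋ : p ∣ n ⇒ p ≥ z}`. [cite: MatomakiMerikoski2023, §3.1 (eq:f(n)/n_average), (eq:Mertens)] -/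
theorem exists_sum_rough_sigma_zero_pow_div_le' (k : ℕ) :
    ∃ C : ℝ, 0 < C ∧ ∀ z x : ℝ, 1 < z → z ≤ x →
      ∑ d ∈ (Icc 1 ⌊x⌋₊).filter (fun n => ∀ p ∈ n.primeFactors, z ≤ ((p : ℕ) : ℝ)),
          ((σ 0 d : ℕ) : ℝ) ^ k / d ≤ C * (Real.log x / Real.log z) ^ 2 ^ k := by
  obtain ⟨C, hC, h⟩ := exists_sum_rough_sigma_zero_pow_div_le k
  refine ⟨C, hC, fun z x hz hzx => ?_⟩
  rw [filter_primeFactors_ge_eq]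
  exact h z x hz hzx

end RoughSums

end Literature.NumberTheory.Sieve
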